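import Summits.ABC.IUTFork.Joshi.TestGenuinePinsVacuityDegreeCut
import Summits.ABC.IUTFork.Joshi.TestGenuinePinsVacuityQuadraticField
import Literature.NumberTheory.NumberFields.MinkowskiRootDiscriminantThresholds
import HarnessLib

/-!
# Branch E TEST — THE DEGREE CUT: the genuine-carrier pins force `[F:ℚ] ∈ {1, 4, 6}` (R-J row Y-26, riders R-23a + R-23b)

Proof-only composition (abc-iut cell, D-0079 R-J «Joshi Y-discharge census», row Y-26; seat abc-iut-E-t32, gen 11; 0 definitions, no
`Prop` fact, FACT rows used: none; abc-iut-E-plan's ruling 2026-08-27T03:43:40Z) of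

* R-23b, this seat's `Joshi/TestGenuinePinsVacuityDegreeCut.lean` (p494605): `PinnedRegions` at abc-iut-c312-7's genuine carrier
  `settingPrVolSharp` ⇒ `|d_F| ≤ 12^{⌊[F:ℚ]/2⌋}` (through p489924 (B2), the exact dyadic different p493580 and the fixed-ball discriminant
  formula p494173), with its contrapositive `not_pinnedRegions_settingPrVolSharp_of_twelve_pow_lt_abs_discr`;
* R-23a, abc-iut-f-072's `Literature/NumberTheory/NumberFields/MinkowskiRootDiscriminantThresholds.lean` (p494478 + v2): Mathlib's exact
  Minkowski bound `NumberField.abs_discr_ge'` gives `12^{⌊[K:ℚ]/2⌋} < |d_K|` exactly for `[K:ℚ] ∈ {3, 5, 7} ∪ [8, ∞)`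
  (`twelve_pow_half_lt_abs_discr_of_ne`; NOT for `4`, `6`: `43 < 144`, `986 < 1728`);
* abc-iut-E-t43's `Joshi/TestGenuinePinsVacuityQuadraticField.lean` (p461949): every QUADRATIC field has empty pins.

RESULTS (same frozen conclusion and binder block as p489924 / p494605, every binder universally quantified):

* **`not_pinnedRegions_settingPrVolSharp_of_le_finrank_of_ne`** — `3 ≤ [F:ℚ]`, `[F:ℚ] ≠ 4`, `[F:ℚ] ≠ 6` ⇒ `PinnedRegions` FAILS;
* **`finrank_eq_of_pinnedRegions_settingPrVolSharp`** — `PinnedRegions` ⇒ `[F:ℚ] = 1 ∨ [F:ℚ] = 4 ∨ [F:ℚ] = 6`;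
* the `PinnedRegions3` forms.

CONSEQUENCE FOR THE RECORD (tree currency, no side taken): the kernel residual class of row Y-26 is cut to `F = ℚ` (INHABITED,
p463284/p463655) or `F` a QUARTIC or SEXTIC field (no quadratic subfield, `|d_F| = 4^{#A}·3^{#B}` with every ramified place
`ℚ₃(ζ₃)`- or `ℚ₂(√3)`-shaped); that no such quartic/sextic field exists (minimal-discriminant tables: Pohst 1982 for degree `6`; the quartic cell
R-32) is a PAPER statement NOT claimed here.  HONEST SCOPE: OUR interface's pins at OUR sharp real container under Dupuy–Hilado's typed
(Ind2); print's (xi-e)/(xi-f) untouched; locates / conditionally verifies; no abc claim. [claim: Mochizuki2012, status: disputed]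
[cite: DupuyHilado2025, §4.9] [cite: NeukirchANT1999, Ch. III (2.9), (2.11), (2.14)] [cite: EsmondeMurty1999, Ex. 6.5.21 p. 93]
-/

noncomputable section

open Set Function NumberField IsDedekindDomain Metric
open scoped Pointwise Classical

namespace Summit.ABC.IUTFork.Joshi

open Thm311 Thm311.Real Cor312 Cor312Vol Literature.IUT.LogThetaLattice Literature.IUT.LogVolume
  Literature.IUT.HodgeTheaters Literature.NumberTheory.NumberFields
open Literature.NumberTheory.GaloisRepresentations.Ultrametric
open GenuinePinsResidual GenuinePinsDividingLine

/-! ## 3. At `settingPrVolSharp`: positive information from the pins -/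

variable {F : Type} [Field F] [NumberField F] (X : PilotData F)
  (M : Type) [Field M] [NumberField M]
  (archPk : ∀ (j : (thetaIndex X).Label) (vQ : (thetaIndex X).VQ), Set ((logShellsDH X (analyticLogv F)).Packet j vQ))
  (archSub : ∀ (j : (thetaIndex X).Label) (v : (thetaIndex X).V),
    Set ((logShellsDH X (analyticLogv F)).Packet j ((thetaIndex X).over v)))
  (Ψ : ℤ → ∀ v : (thetaIndex X).V, v ∈ (thetaIndex X).Vbad → Set ((logShellsDH X (analyticLogv F)).StarPacket v))
  (act : ℤ → ∀ v : (thetaIndex X).V, v ∈ (thetaIndex X).Vbad →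
    (logShellsDH X (analyticLogv F)).StarPacket v → Module.End ℚ ((logShellsDH X (analyticLogv F)).StarPacket v))
  (Mmod : ℤ → ∀ j : (thetaIndex X).LabelStar, Set ((logShellsDH X (analyticLogv F)).GlobalPacket j.1))
  (region : ℤ → ∀ j : (thetaIndex X).LabelStar, FinDivisor M → ∀ vQ : (thetaIndex X).VQ,
    Set ((logShellsDH X (analyticLogv F)).Packet j.1 vQ))
  (frobAdm : ℤ → ℤ → ∀ (j : (thetaIndex X).Label) (vQ : (thetaIndex X).VQ),
    Set ((logShellsDH X (analyticLogv F)).Packet j vQ) → Prop)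
  (frobLogvol : ℤ → ℤ → ∀ (j : (thetaIndex X).Label) (vQ : (thetaIndex X).VQ),
    Set ((logShellsDH X (analyticLogv F)).Packet j vQ) → ℝ)
  (frobΨ : ℤ → ℤ → ∀ v : (thetaIndex X).V, v ∈ (thetaIndex X).Vbad → Set ((logShellsDH X (analyticLogv F)).StarPacket v))
  (frobMmod : ℤ → ℤ → ∀ j : (thetaIndex X).LabelStar, Set ((logShellsDH X (analyticLogv F)).GlobalPacket j.1))
  (unitImage : ℤ → ℤ → ℕ → ∀ (j : (thetaIndex X).Label) (vQ : (thetaIndex X).VQ),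
    Set ((logShellsDH X (analyticLogv F)).Packet j vQ))
  (ballImage : ℤ → ℤ → ∀ (j : (thetaIndex X).Label) (vQ : (thetaIndex X).VQ),
    Set ((logShellsDH X (analyticLogv F)).Packet j vQ))
  (thetaDiv : ℤ → ℤ → LgpDivisor M (thetaIndex X).lstar)
  (n : ℤ) {HT : Type} {LogLink : HT → HT → Type} {IsFull : ∀ {s t : HT}, LogLink s t → Prop}
  (lat : LGPGaussianLogThetaLattice LogLink IsFull)
  {Frd : Type} {IsoF : Frd → Frd → Type} {Ob : Frd → Type} {realify : Frd → Frd} {Strip : Type}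
  {IsoS : Strip → Strip → Type} {Mv : ∀ v : (thetaIndex X).V, v ∈ (thetaIndex X).Vbad → Type}
  [∀ v h, Monoid (Mv v h)]
  (sig : GlobalLGPFrobenioidSignature (thetaIndex X).lstar (thetaIndex X).V (· ∈ (thetaIndex X).Vbad)
    Frd IsoF Ob realify Strip IsoS Mv)
  (split : SplittingMonoids Mv) {ObΔ : Type} {N : ∀ v : (thetaIndex X).V, v ∈ (thetaIndex X).Vbad → Type}
  [∀ v h, Monoid (N v h)] (qData : QPilotData ObΔ N)
  (t : ∀ (pp : Nat.Primes) (_ : Fin X.lstar) (x : (thetaIndex X).Fibre (.inr pp)),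
    haveI : Fact (pp : ℕ).Prime := ⟨pp.2⟩; kOf X pp.1 x)
  (tq : ∀ (pp : Nat.Primes) (x : (thetaIndex X).Fibre (.inr pp)), haveI : Fact (pp : ℕ).Prime := ⟨pp.2⟩; kOf X pp.1 x)
  (ρ : (∀ v : (thetaIndex X).V, v ∈ (thetaIndex X).Vbad → Set ((logShellsDH X (analyticLogv F)).StarPacket v)) →
    ∀ (j : (thetaIndex X).Label) (vQ : (thetaIndex X).VQ), Set ((logShellsDH X (analyticLogv F)).Packet j vQ))
  (qK : ∀ v : (thetaIndex X).V, v ∈ (thetaIndex X).Vbad → Set ((logShellsDH X (analyticLogv F)).StarPacket v))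
  (htq0 : ∀ pp x, tq pp x ≠ 0)
  (htq1 : ∀ (pp : Nat.Primes) (x : (thetaIndex X).Fibre (.inr pp)),
    haveI : Fact (pp : ℕ).Prime := ⟨pp.2⟩; placeOf X pp.1 x ∉ X.S → ‖tq pp x‖ = 1)


/-- **THE DEGREE CUT, negative form: every number field `F` with `3 ≤ [F:ℚ]`, `[F:ℚ] ≠ 4`, `[F:ℚ] ≠ 6` has KERNEL-EMPTY pins at
`settingPrVolSharp`** (analytic logarithms, every `X`, `ρ`, `qK`, column data, `Ψ`, ideles, column): Minkowski `12^{⌊n/2⌋} < |d_F|`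
(R-23a) against the pins-forced `|d_F| ≤ 12^{⌊n/2⌋}` (R-23b). [cite: NeukirchANT1999, Ch. III (2.14)] [claim: Mochizuki2012, status: disputed] -/
theorem not_pinnedRegions_settingPrVolSharp_of_le_finrank_of_ne (h3 : 3 ≤ Module.finrank ℚ F) (h4 : Module.finrank ℚ F ≠ 4)
    (h6 : Module.finrank ℚ F ≠ 6) :
    ¬ Cor312Vol.PinnedRegions
      (LatticeSituation.ofShells (logShellsDH X (analyticLogv F)) M archPk archSub
        (summandPiecesPr X (logvAnalytic_analyticLogv (F := F))).Adm
        (summandPiecesPr X (logvAnalytic_analyticLogv (F := F))).logvol Ψ act Mmod region frobAdm frobLogvol frobΨ frobMmod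
        unitImage ballImage thetaDiv)
      (settingPrVolSharp X (logvAnalytic_analyticLogv (F := F)) M archPk archSub Ψ act Mmod region n lat sig split qData tq t
        htq0 htq1) ρ qK :=
  not_pinnedRegions_settingPrVolSharp_of_twelve_pow_lt_abs_discr X M archPk archSub Ψ act Mmod region frobAdm frobLogvol frobΨ
      frobMmod unitImage ballImage thetaDiv n lat sig split qData t tq ρ qK htq0 htq1 (twelve_pow_half_lt_abs_discr_of_ne F h3 h4 h6)

/-- The same for `PinnedRegions3`. [claim: Mochizuki2012, status: disputed] -/
theorem not_pinnedRegions3_settingPrVolSharp_of_le_finrank_of_ne (h3 : 3 ≤ Module.finrank ℚ F) (h4 : Module.finrank ℚ F ≠ 4)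
    (h6 : Module.finrank ℚ F ≠ 6) :
    ¬ Cor312Vol.PinnedRegions3
      (LatticeSituation.ofShells (logShellsDH X (analyticLogv F)) M archPk archSub
        (summandPiecesPr X (logvAnalytic_analyticLogv (F := F))).Adm
        (summandPiecesPr X (logvAnalytic_analyticLogv (F := F))).logvol Ψ act Mmod region frobAdm frobLogvol frobΨ frobMmod
        unitImage ballImage thetaDiv)
      (settingPrVolSharp X (logvAnalytic_analyticLogv (F := F)) M archPk archSub Ψ act Mmod region n lat sig split qData tq t
        htq0 htq1) ρ qK :=
  fun h => not_pinnedRegions_settingPrVolSharp_of_le_finrank_of_ne X M archPk archSub Ψ act Mmod region frobAdm frobLogvol frobΨ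
      frobMmod unitImage ballImage thetaDiv n lat sig split qData t tq ρ qK htq0 htq1 h3 h4 h6 h.1

/-- **THE DEGREE CUT, first form: `PinnedRegions` at `settingPrVolSharp` ⇒ `[F:ℚ] ∈ {1, 2, 4, 6}`** (R-23a + R-23b alone).
[cite: NeukirchANT1999, Ch. III (2.14)] [claim: Mochizuki2012, status: disputed] -/
theorem finrank_eq_one_or_two_or_four_or_six_of_pinnedRegions_settingPrVolSharp
    (hpin : Cor312Vol.PinnedRegions
      (LatticeSituation.ofShells (logShellsDH X (analyticLogv F)) M archPk archSub
        (summandPiecesPr X (logvAnalytic_analyticLogv (F := F))).Adm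
        (summandPiecesPr X (logvAnalytic_analyticLogv (F := F))).logvol Ψ act Mmod region frobAdm frobLogvol frobΨ frobMmod
        unitImage ballImage thetaDiv)
      (settingPrVolSharp X (logvAnalytic_analyticLogv (F := F)) M archPk archSub Ψ act Mmod region n lat sig split qData tq t
        htq0 htq1) ρ qK) :
    Module.finrank ℚ F = 1 ∨ Module.finrank ℚ F = 2 ∨ Module.finrank ℚ F = 4 ∨ Module.finrank ℚ F = 6 := by
  have hpos : 0 < Module.finrank ℚ F := Module.finrank_pos
  by_contra hne
  push Not at hne
  obtain ⟨h1, h2, h4, h6⟩ := hne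
  exact not_pinnedRegions_settingPrVolSharp_of_le_finrank_of_ne X M archPk archSub Ψ act Mmod region frobAdm frobLogvol frobΨ
      frobMmod unitImage ballImage thetaDiv n lat sig split qData t tq ρ qK htq0 htq1 (by omega) h4 h6 hpin

/-- **THE DEGREE CUT: `PinnedRegions` at `settingPrVolSharp` ⇒ `[F:ℚ] = 1 ∨ [F:ℚ] = 4 ∨ [F:ℚ] = 6`** — the quadratic degree is
abc-iut-E-t43's p461949 (`not_pinnedRegions_settingPrVolSharp_of_finrank_eq_two`, every quadratic field, hypothesis-free).
[cite: NeukirchANT1999, Ch. III (2.14)] [claim: Mochizuki2012, status: disputed] -/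
theorem finrank_eq_of_pinnedRegions_settingPrVolSharp
    (hpin : Cor312Vol.PinnedRegions
      (LatticeSituation.ofShells (logShellsDH X (analyticLogv F)) M archPk archSub
        (summandPiecesPr X (logvAnalytic_analyticLogv (F := F))).Adm
        (summandPiecesPr X (logvAnalytic_analyticLogv (F := F))).logvol Ψ act Mmod region frobAdm frobLogvol frobΨ frobMmod
        unitImage ballImage thetaDiv)
      (settingPrVolSharp X (logvAnalytic_analyticLogv (F := F)) M archPk archSub Ψ act Mmod region n lat sig split qData tq t
        htq0 htq1) ρ qK) :
    Module.finrank ℚ F = 1 ∨ Module.finrank ℚ F = 4 ∨ Module.finrank ℚ F = 6 := by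
  rcases finrank_eq_one_or_two_or_four_or_six_of_pinnedRegions_settingPrVolSharp X M archPk archSub Ψ act Mmod region frobAdm frobLogvol frobΨ
      frobMmod unitImage ballImage thetaDiv n lat sig split qData t tq ρ qK htq0 htq1 hpin with h1 | h2 | h4 | h6
  · exact Or.inl h1
  · exact absurd hpin (not_pinnedRegions_settingPrVolSharp_of_finrank_eq_two X M archPk archSub Ψ act Mmod region frobAdm frobLogvol frobΨ
      frobMmod unitImage ballImage thetaDiv n lat sig split qData t tq ρ qK htq0 htq1 h2)
  · exact Or.inr (Or.inl h4)
  · exact Or.inr (Or.inr h6)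

/-- The same read from `PinnedRegions3`. [claim: Mochizuki2012, status: disputed] -/
theorem finrank_eq_of_pinnedRegions3_settingPrVolSharp
    (hpin : Cor312Vol.PinnedRegions3
      (LatticeSituation.ofShells (logShellsDH X (analyticLogv F)) M archPk archSub
        (summandPiecesPr X (logvAnalytic_analyticLogv (F := F))).Adm
        (summandPiecesPr X (logvAnalytic_analyticLogv (F := F))).logvol Ψ act Mmod region frobAdm frobLogvol frobΨ frobMmod
        unitImage ballImage thetaDiv)
      (settingPrVolSharp X (logvAnalytic_analyticLogv (F := F)) M archPk archSub Ψ act Mmod region n lat sig split qData tq t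
        htq0 htq1) ρ qK) :
    Module.finrank ℚ F = 1 ∨ Module.finrank ℚ F = 4 ∨ Module.finrank ℚ F = 6 :=
  finrank_eq_of_pinnedRegions_settingPrVolSharp X M archPk archSub Ψ act Mmod region frobAdm frobLogvol frobΨ
      frobMmod unitImage ballImage thetaDiv n lat sig split qData t tq ρ qK htq0 htq1 hpin.1

end Summit.ABC.IUTFork.Joshi

end
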